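import Summits.FinalStateConjecture.FinalStateConjecture.Theses.BondiDrainDispersal
import Summits.FinalStateConjecture.FinalStateConjecture.Theorems.BondiDrainDispersalHorizonlessMustDrainNormalForm
import Literature.Geometry.Lorentzian.EventHorizon
import Literature.Geometry.Lorentzian.CausalityPushUp
import Literature.Geometry.Lorentzian.CausalityChronologyProofs
import Literature.Geometry.Lorentzian.NormalisedNullRayCausal
import Literature.Geometry.Lorentzian.MinkowskiGlobalHyperbolicity
import Literature.Geometry.Lorentzian.LeviCivitaProofs
import HarnessLib

/-!
# Crux `DrainImpliesDisperse` (stmt-FinalStateConjecture-17283): under the horizonless hypothesis the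
# no-horizon clause (E6) of a radiative end is a statement at infinity

Line `registered` of the crux (`Cruxes/DrainImpliesDisperse/Lines/birth.lean`) cuts the dispersive
`N = 0` decomposition at a RADIATIVE END `(τ₀, Ψ)` whose causal clause is

  (E6) `J⁺(ι X) ⊆ I⁻(U)`, `U := Ψ{x⁰ > τ₀}` — the black-hole region RELATIVE TO THE END is empty.

The route's assembly (`Theses.BondiDrainDispersal.closes`) applies the crux only inside the branch in
which the development has NO EVENT HORIZON in the ray-theoretic sense (the inlined hypothesis of
`CensoredHorizonlessDisperse`/`HorizonlessMustDrain`; by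
`BondiDrainDispersalHorizonlessMustDrain.noHorizon_iff_visibleRegion_eq_univ` it reads
`𝒟.visibleRegion = univ`, i.e. `I⁻(𝓡) = M` for the complete-ray region
`𝓡 = completeNullRayRegion`, the intrinsic stand-in for `𝓘⁺`). Lead c6 (REPORT-c6) recommends restating
the crux with that hypothesis in context (C‴/C″). This file proves, for EVERY Cauchy development and
EVERY set `U`, the causal bookkeeping that then localises (E6) at infinity:

* `chronologicalPast_eq_univ_of_visibleRegion_eq_univ` — if `I⁻(𝓡) = M` and every point of `𝓡`
  causally precedes a point of `I⁻(U)` (`𝓡 ⊆ J⁻(I⁻(U))`), then `I⁻(U) = M` (push-up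
  `I⁻(J⁻ S) = I⁻(S)` and transitivity of `≪`); in particular (E6);
* `completeNullRayRegion_subset_chronologicalPast_of_causalFuture_subset` — conversely (E6) puts
  `𝓡 ⊆ I⁻(U)` (`𝓡 ⊆ J⁺(ι X)`), with no hypothesis;
* `causalFuture_subset_chronologicalPast_iff_of_visibleRegion_eq_univ` — hence, in a horizonless
  development, (E6) ⟺ `𝓡 ⊆ I⁻(U)` ⟺ `I⁻(U) = M`: **the end has no horizon iff it is visible from
  every point of (intrinsic) `𝓘⁺`** — a clause about the far parts of complete rays only, which is
  where exterior stability theorems operate;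
* `completeNullRayRegion_subset_causalPast_of_cofinal` — the COFINAL SIGNALLING form suffices: if
  along every future-complete normalised ray from the data there are arbitrarily late parameters at
  which the ray lies in `I⁻(U)`, then `𝓡 ⊆ J⁻(I⁻(U))` (points of a ray are causally ordered); this is
  the residual goal that lead c2's worker isolated when `stub_completeRaysSignal` came back
  `stub-misstated`, now discharged UNDER the horizonless hypothesis;
* `causalFuture_subset_chronologicalPast_of_noHorizon_of_cofinal` — the engine-facing corollary in
  the binder conventions of the route: the inlined horizonless hypothesis (verbatim) + cofinal
  signalling of complete rays to `Ψ{x⁰ > τ₀}` ⇒ (E6) verbatim as registered in `stub_radiativeEnd_CK`.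

Helper file (`--supports stmt-FinalStateConjecture-17283`); pure causal geometry (O'Neill 1983,
Ch. 14, Cor. 14.1 and p. 403), no field equation, no decay; it proves no route item.
-/

noncomputable section

open Set Filter Literature.Geometry.Lorentzian
open scoped Manifold ContDiff Topology

namespace Summit.FinalStateConjecture.FinalStateConjecture.Theorems.DrainImpliesDisperse

-- D-0017: single-problem summit, `Summit.<S>.<S>.…` by design.
set_option linter.dupNamespace false

/-! ### Causal lemmas (any time-oriented Lorentzian manifold without boundary) -/

section Causal

variable {E : Type*} [NormedAddCommGroup E] [NormedSpace ℝ E] {H : Type*} [TopologicalSpace H]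
  {I : ModelWithCorners ℝ E H} {n : ℕ∞ω} {M : Type*} [TopologicalSpace M] [ChartedSpace H M]
  [IsManifold I ∞ M] {g : LorentzianMetric I n M} {τ : TimeOrientation g}

/-- **Push-up in the past**: `I⁻(J⁻(S)) = I⁻(S)` on a finite-dimensional manifold without boundary
(`Cⁿ` metric, `n ≥ 1`) — the time dual of `I⁺(J⁺ S) = I⁺(S)`. O'Neill 1983, Ch. 14, Cor. 14.1 and p. 403.
[cite: ONeillSemiRiemannian1983, Ch. 14, Cor. 14.1 (p. 402) and p. 403] -/
theorem chronologicalPast_causalPast_eq [BoundarylessManifold I M] [FiniteDimensional ℝ E]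
    (hn : 1 ≤ n) (S : Set M) :
    g.chronologicalPast τ (g.causalPast τ S) = g.chronologicalPast τ S :=
  LorentzianMetric.chronologicalFuture_causalFuture_eq_of_boundaryless (τ := τ.reverse) hn S

/-- **Transitivity of `≪` in the past**: `I⁻(I⁻(S)) ⊆ I⁻(S)`. O'Neill 1983, Ch. 14, p. 402.
[cite: ONeillSemiRiemannian1983, Ch. 14, p. 402] -/
theorem chronologicalPast_chronologicalPast_subset (S : Set M) :
    g.chronologicalPast τ (g.chronologicalPast τ S) ⊆ g.chronologicalPast τ S := by
  intro r hr
  change r ∈ g.chronologicalFuture τ.reverse (g.chronologicalFuture τ.reverse S) at hr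
  rw [LorentzianMetric.chronologicalFuture_eq_biUnion] at hr
  simp only [mem_iUnion, exists_prop] at hr
  obtain ⟨q, hq, hrq⟩ := hr
  exact LorentzianMetric.mem_chronologicalFuture_trans hq hrq

/-- **A universally visible set hands its visibility on.** If every event lies in `I⁻(R)` and every
point of `R` causally precedes some point of `I⁻(U)` (`R ⊆ J⁻(I⁻(U))`), then every event lies in
`I⁻(U)`: `M = I⁻(R) ⊆ I⁻(J⁻(I⁻ U)) = I⁻(I⁻ U) ⊆ I⁻(U)`. O'Neill 1983, Ch. 14, Cor. 14.1 and p. 403.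
[cite: ONeillSemiRiemannian1983, Ch. 14, Cor. 14.1 (p. 402) and p. 403] -/
theorem chronologicalPast_eq_univ_of_subset_causalPast [BoundarylessManifold I M]
    [FiniteDimensional ℝ E] (hn : 1 ≤ n) {R U : Set M}
    (hR : g.chronologicalPast τ R = univ)
    (hRU : R ⊆ g.causalPast τ (g.chronologicalPast τ U)) :
    g.chronologicalPast τ U = univ := by
  refine eq_univ_of_univ_subset fun q _ ↦ ?_
  have hq : q ∈ g.chronologicalPast τ R := hR ▸ mem_univ q
  have hq' : q ∈ g.chronologicalPast τ (g.causalPast τ (g.chronologicalPast τ U)) :=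
    LorentzianMetric.chronologicalFuture_mono (τ := τ.reverse) hRU hq
  rw [chronologicalPast_causalPast_eq hn] at hq'
  exact chronologicalPast_chronologicalPast_subset _ hq'

/-- Along a future causal curve on an interval, a later point lies in the causal future of an earlier
one. O'Neill 1983, Ch. 14, p. 402. [cite: ONeillSemiRiemannian1983, Ch. 14, p. 402] -/
theorem mem_causalFuture_of_isFutureCausalCurveOn {γ : ℝ → M} {s : Set ℝ}
    (hγ : g.IsFutureCausalCurveOn τ γ s) (hs : s.OrdConnected) {a b : ℝ} (ha : a ∈ s) (hb : b ∈ s)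
    (hab : a ≤ b) : γ b ∈ g.causalFuture τ {γ a} := by
  rcases hab.eq_or_lt with rfl | hlt
  · exact LorentzianMetric.subset_causalFuture g τ _ (mem_singleton _)
  · exact Or.inr ⟨γ a, rfl, γ, a, b, hlt, hγ.mono (hs.out ha hb), rfl, rfl⟩

end Causal

/-! ### Radiative ends of horizonless developments -/

section Development

variable {X : Type} [TopologicalSpace X] [ChartedSpace E3 X] [IsManifold (𝓡 3) ∞ X]
  [ConnectedSpace X] {D : InitialDataSet (𝓡 3) X}

/-- `1 ≤ ∞` in `ℕ∞ω` (regularity side condition of push-up). [folklore] -/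
private lemma one_le_infty : (1 : ℕ∞ω) ≤ ((⊤ : ℕ∞) : ℕ∞ω) := WithTop.coe_le_coe.mpr le_top

/-- **In a horizonless development a set visible from all of `𝓘⁺` is visible from everywhere.** If the
visible region of the Cauchy development `𝒟` is everything (`I⁻(𝓡) = M`, `𝓡` the complete-ray region —
the ray-theoretic "no event horizon" of route `BondiDrainDispersal`) and every point of `𝓡` causally
precedes a point of `I⁻(U)`, then `I⁻(U) = M`. O'Neill 1983, Ch. 14, Cor. 14.1; Hawking–Ellis 1973, §9.2,
p. 312 (`J⁻(𝓘⁺)`). [cite: ONeillSemiRiemannian1983, Ch. 14, Cor. 14.1 (p. 402) and p. 403] -/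
theorem chronologicalPast_eq_univ_of_visibleRegion_eq_univ (𝒟 : CauchyDevelopment D)
    [𝒟.metric.HasLeviCivita] (hvis : 𝒟.toDataEmbedding.visibleRegion = univ) {U : Set 𝒟.carrier}
    (hRU : 𝒟.toDataEmbedding.completeNullRayRegion ⊆
      𝒟.metric.causalPast 𝒟.timeOrientation (𝒟.metric.chronologicalPast 𝒟.timeOrientation U)) :
    𝒟.metric.chronologicalPast 𝒟.timeOrientation U = univ := by
  refine chronologicalPast_eq_univ_of_subset_causalPast one_le_infty ?_ hRU
  change 𝒟.metric.chronologicalPast 𝒟.timeOrientation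
      (𝒟.metric.completeNullRayRegion 𝒟.timeOrientation 𝒟.embed 𝒟.normal) = univ
  rw [LorentzianMetric.chronologicalPast_completeNullRayRegion]
  exact hvis

/-- **(E6) in a horizonless development from visibility of the end at infinity**: if `I⁻(𝓡) = M` and
`𝓡 ⊆ J⁻(I⁻(U))`, then `J⁺(ι X) ⊆ I⁻(U)` — the no-horizon clause (E6) of a radiative end with late region
`U`. [cite: ONeillSemiRiemannian1983, Ch. 14, Cor. 14.1 (p. 402) and p. 403] -/
theorem causalFuture_subset_chronologicalPast_of_visibleRegion_eq_univ (𝒟 : CauchyDevelopment D)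
    [𝒟.metric.HasLeviCivita] (hvis : 𝒟.toDataEmbedding.visibleRegion = univ) {U : Set 𝒟.carrier}
    (hRU : 𝒟.toDataEmbedding.completeNullRayRegion ⊆
      𝒟.metric.causalPast 𝒟.timeOrientation (𝒟.metric.chronologicalPast 𝒟.timeOrientation U)) :
    𝒟.metric.causalFuture 𝒟.timeOrientation (range 𝒟.embed) ⊆
      𝒟.metric.chronologicalPast 𝒟.timeOrientation U := by
  rw [chronologicalPast_eq_univ_of_visibleRegion_eq_univ 𝒟 hvis hRU]
  exact subset_univ _

/-- **The converse needs no hypothesis**: (E6) `J⁺(ι X) ⊆ I⁻(U)` puts the whole complete-ray region in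
`I⁻(U)` (`𝓡 ⊆ J⁺(ι X)`, `completeNullRayRegion_subset_causalFuture`). [cite: ONeillSemiRiemannian1983, Ch. 14, p. 402] -/
theorem completeNullRayRegion_subset_chronologicalPast_of_causalFuture_subset (𝒟 : CauchyDevelopment D)
    [𝒟.metric.HasLeviCivita] {U : Set 𝒟.carrier}
    (hE6 : 𝒟.metric.causalFuture 𝒟.timeOrientation (range 𝒟.embed) ⊆
      𝒟.metric.chronologicalPast 𝒟.timeOrientation U) :
    𝒟.toDataEmbedding.completeNullRayRegion ⊆ 𝒟.metric.chronologicalPast 𝒟.timeOrientation U :=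
  (LorentzianMetric.completeNullRayRegion_subset_causalFuture 𝒟.metric 𝒟.timeOrientation 𝒟.embed
    𝒟.normal).trans hE6

/-- **In a horizonless development, (E6) ⟺ the end is visible from all of `𝓘⁺`.** If `I⁻(𝓡) = M`
then `J⁺(ι X) ⊆ I⁻(U)` iff `𝓡 ⊆ I⁻(U)` — the no-horizon clause of a radiative end is a statement about
the far parts of the complete rays only. [cite: ONeillSemiRiemannian1983, Ch. 14, Cor. 14.1 (p. 402) and p. 403] -/
theorem causalFuture_subset_chronologicalPast_iff_of_visibleRegion_eq_univ (𝒟 : CauchyDevelopment D)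
    [𝒟.metric.HasLeviCivita] (hvis : 𝒟.toDataEmbedding.visibleRegion = univ) (U : Set 𝒟.carrier) :
    𝒟.metric.causalFuture 𝒟.timeOrientation (range 𝒟.embed) ⊆
        𝒟.metric.chronologicalPast 𝒟.timeOrientation U ↔
      𝒟.toDataEmbedding.completeNullRayRegion ⊆ 𝒟.metric.chronologicalPast 𝒟.timeOrientation U :=
  ⟨completeNullRayRegion_subset_chronologicalPast_of_causalFuture_subset 𝒟,
    fun h ↦ causalFuture_subset_chronologicalPast_of_visibleRegion_eq_univ 𝒟 hvis
      (h.trans (LorentzianMetric.subset_causalPast 𝒟.metric 𝒟.timeOrientation _))⟩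

/-- **In a horizonless development, (E6) ⟺ `I⁻(U)` is everything.** [cite: ONeillSemiRiemannian1983, Ch. 14, Cor. 14.1 (p. 402) and p. 403] -/
theorem causalFuture_subset_chronologicalPast_iff_eq_univ_of_visibleRegion_eq_univ
    (𝒟 : CauchyDevelopment D) [𝒟.metric.HasLeviCivita]
    (hvis : 𝒟.toDataEmbedding.visibleRegion = univ) (U : Set 𝒟.carrier) :
    𝒟.metric.causalFuture 𝒟.timeOrientation (range 𝒟.embed) ⊆
        𝒟.metric.chronologicalPast 𝒟.timeOrientation U ↔
      𝒟.metric.chronologicalPast 𝒟.timeOrientation U = univ := by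
  refine ⟨fun h ↦ ?_, fun h ↦ h ▸ subset_univ _⟩
  exact chronologicalPast_eq_univ_of_visibleRegion_eq_univ 𝒟 hvis
    ((completeNullRayRegion_subset_chronologicalPast_of_causalFuture_subset 𝒟 h).trans
      (LorentzianMetric.subset_causalPast 𝒟.metric 𝒟.timeOrientation _))

/-- **Cofinal signalling suffices.** If along every future-complete normalised null ray `γ` from the
data and for every parameter `t` of its domain there is a later parameter `t' ≥ t` with `γ t' ∈ I⁻(U)`,
then every point of the complete-ray region causally precedes a point of `I⁻(U)` (`𝓡 ⊆ J⁻(I⁻(U))`):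
the points of a ray are causally ordered along it. This is the residual goal of the birth stub
`stub_completeRaysSignal` (lead c2, worker verdict `stub-misstated`), in the form the horizonless
hypothesis turns into (E6). [cite: ONeillSemiRiemannian1983, Ch. 14, p. 402] -/
theorem completeNullRayRegion_subset_causalPast_of_cofinal (𝒟 : CauchyDevelopment D)
    [𝒟.metric.HasLeviCivita] {U : Set 𝒟.carrier}
    (hsig : ∀ (p : X) (γ : ℝ → 𝒟.carrier) (dom : Set ℝ),
      𝒟.metric.IsNormalisedNullRayFrom 𝒟.timeOrientation 𝒟.embed 𝒟.normal p γ dom →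
        ¬ BddAbove dom → ∀ t ∈ dom, ∃ t' ∈ dom, t ≤ t' ∧
          γ t' ∈ 𝒟.metric.chronologicalPast 𝒟.timeOrientation U) :
    𝒟.toDataEmbedding.completeNullRayRegion ⊆
      𝒟.metric.causalPast 𝒟.timeOrientation (𝒟.metric.chronologicalPast 𝒟.timeOrientation U) := by
  intro q hq
  obtain ⟨p, γ, dom, t, hγ, hdom, ht, -, rfl⟩ :=
    LorentzianMetric.mem_completeNullRayRegion_iff.1 hq
  obtain ⟨t', ht', htt', hγt'⟩ := hsig p γ dom hγ hdom t ht
  -- `γ t ≤ γ t'` along the ray, and `γ t' ∈ I⁻(U)`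
  have hJ : γ t' ∈ 𝒟.metric.causalFuture 𝒟.timeOrientation {γ t} :=
    mem_causalFuture_of_isFutureCausalCurveOn hγ.isFutureCausalCurveOn
      hγ.isMaximalGeodesicOn.2.1 ht ht' htt'
  exact LorentzianMetric.causalFuture_mono (τ := 𝒟.timeOrientation.reverse)
    (singleton_subset_iff.2 hγt') (LorentzianMetric.mem_causalPast_of_mem_causalFuture hJ)

end Development

/-! ### The engine-facing corollary (registered helper stub, signature verbatim) -/

/-- **(E6) for a radiative end of a HORIZONLESS development from cofinal signalling of the complete
rays** — the engine-facing corollary, in the binder conventions of route `BondiDrainDispersal`: for a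
vacuum Cauchy development `𝒟` satisfying the inlined ray-theoretic horizonless hypothesis of
`CensoredHorizonlessDisperse` (verbatim), every `τ₀` and every `Ψ : E4 → M` such that each
future-complete normalised null ray from the data lies in `I⁻(Ψ{x⁰ > τ₀})` at arbitrarily late
parameters, the no-horizon clause (E6) of the registered stub `stub_radiativeEnd_CK` holds verbatim:
`J⁺(ι X) ⊆ I⁻(Ψ{x⁰ > τ₀})`. Under the restatement C″/C‴ of the crux (REPORT-c6) this replaces (E6) by a
clause about the far parts of complete rays. [cite: ONeillSemiRiemannian1983, Ch. 14, Cor. 14.1 (p. 402) and p. 403] -/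
theorem causalFuture_subset_chronologicalPast_of_noHorizon_of_cofinal : ∀ {X : Type} [TopologicalSpace X] [ChartedSpace E3 X] [IsManifold (𝓡 3) ∞ X] [ConnectedSpace X] {D : InitialDataSet (𝓡 3) X} (𝒟 : VacuumCauchyDevelopment D) [𝒟.metric.HasLeviCivita], (¬ ∀ [𝒟.metric.HasLeviCivita], ∃ q : 𝒟.carrier, ∀ (p : X) (γ : ℝ → 𝒟.carrier) (dom : Set ℝ), 𝒟.metric.IsNormalisedNullRayFrom 𝒟.timeOrientation 𝒟.embed 𝒟.normal p γ dom → ¬ BddAbove dom → q ∉ 𝒟.metric.chronologicalPast 𝒟.timeOrientation (γ '' (dom ∩ Set.Ici 0))) → ∀ (τ₀ : ℝ) (Ψ : Minkowski.background.domain → 𝒟.carrier), (∀ (p : X) (γ : ℝ → 𝒟.carrier) (dom : Set ℝ), 𝒟.metric.IsNormalisedNullRayFrom 𝒟.timeOrientation 𝒟.embed 𝒟.normal p γ dom → ¬ BddAbove dom → ∀ t ∈ dom, ∃ t' ∈ dom, t ≤ t' ∧ γ t' ∈ 𝒟.metric.chronologicalPast 𝒟.timeOrientation (Ψ '' Minkowski.background.lateRegion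 τ₀)) → 𝒟.metric.causalFuture 𝒟.timeOrientation (range 𝒟.embed) ⊆ 𝒟.metric.chronologicalPast 𝒟.timeOrientation (Ψ '' Minkowski.background.lateRegion τ₀) := by
  intro X _ _ _ _ D 𝒟 _ hH τ₀ Ψ hsig
  have hvis : 𝒟.toDataEmbedding.visibleRegion = univ :=
    (BondiDrainDispersalHorizonlessMustDrain.noHorizon_iff_visibleRegion_eq_univ 𝒟).1 hH
  exact causalFuture_subset_chronologicalPast_of_visibleRegion_eq_univ 𝒟.toCauchyDevelopment hvis
    (completeNullRayRegion_subset_causalPast_of_cofinal 𝒟.toCauchyDevelopment hsig)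

end Summit.FinalStateConjecture.FinalStateConjecture.Theorems.DrainImpliesDisperse

end
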